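import Summits.BirchSwinnertonDyer.BirchSwinnertonDyer.Theorems.SignedLowerHalvesSprungLowerDivisibilityAtThreeRankCut
import Summits.BirchSwinnertonDyer.BirchSwinnertonDyer.Theorems.PrintX8VSConjSpanGenAll
import HarnessLib

/-!
# Route `PrintX8VS` (x8 leaf `WAllCornerX8`) and crux K1 `SprungLowerDivisibilityAtThree` (item stmt-BirchSwinnertonDyer-19875):
# THE x8-SIDE TURNKEY OF THE RANK CUT — the leaf from K_spor, the positive-level part of S4b and the held inputs, with the
# `(T)`-clause of S4b at `r_an ≥ 2` (v8 stub S4b-T) DELETED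

Cell `bsd-ssimc` (host), width seat `cruxlead-stmt-BirchSwinnertonDyer-19875-w2` (g3) under the 19875 lead; `--supports` 19875
`--as helper`; theorems only; closes NO item; registry unchanged (skeleton v8 of record: K_spor `stub_katoFineLowerSporadic`, S4b-cyc
`stub_cyclotomicLowerPosLevel`, S4b-T `stub_cyclotomicLowerAtTHighRank`, S5 `stub_heldInputs`); CALIBRATION in the sense of the pen's word
R-RANKCUT (D34-4) — no item is restated, no x8 verb is asked. Companions: `…SprungLowerDivisibilityAtThreeRankCut.lean` (p620968, per pair)
and `…SprungLowerHalfAtThreeRankZeroGlue.lean` (p621820, route `SignedLowerHalves`). BSD, K1 and leaf X8 are NOT proved by anything here.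

## What is proved

Route `PrintX8VS`'s leaf `WAllCornerX8` («`BSD(E,3)` on every X8 pair of analytic rank `≤ 1`») is reached, in the kernel, by
`PrintX8VSConjSpanGenAll.wAllCornerX8_of_K1_of_heldInputs : K1 → InputSharpFlatMuTransfer → PublishedInputsX8 → RankEqAnalyticRankLeOne →
WAllCornerX8` (THEOREM B `conjSpanGenAll_holds` discharged). Reading its proof: the crux C1 `SharpFlatMainConjectureX8` is TYPED at
`W.analyticRank ≤ 1`, and both glues through which K1 enters — `PrintX8MainConjectureSplit.glueMainConjectureX8_holds` (big image, via
`X8.sprungSharpFlatMainConjecture_of_lowerDivisibility_of_surj`) and `PrintX8MuBoundGlue.glueMuBoundSmallImageX8_holds` (small image, via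
`PrintX8MuReading.X8.sprungSharpFlatMainConjecture_of_lowerDivisibility_of_muInvariant_le`) — apply K1's predicate ONLY at pairs with
`r_an ≤ 1`. Hence (notation of the companions: `hKsp` = K_spor VERBATIM, `hCyc` = S4b-cyc VERBATIM):

* §1 `sharpFlatMainConjectureX8_of_lowerDivisibility_analyticRank_le_one` — **C1 ⟸ «K1's predicate at the X8 pairs with `r_an ≤ 1`» ∧
  `InputSharpFlatMuTransfer` ∧ `PublishedInputsX8`** (THEOREM B inside; the two glues re-run per pair);
* §2 `wAllCornerX8_of_lowerDivisibility_analyticRank_le_one` — **the leaf ⟸ the same ∧ `RankEqAnalyticRankLeOne`** (`PrintX8VSGlue.assembly_holds`);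
* §3 `wAllCornerX8_of_katoSporadic_of_posLevel` — **the leaf ⟸ hKsp ∧ hCyc ∧ `ChromaticHeldInputsX8` (C4 = S5) ∧ `InputSharpFlatMuTransfer` ∧
  `PublishedInputsX8` ∧ `RankEqAnalyticRankLeOne`**, by the companion's class form
  `lowerDivisibility_analyticRank_le_one_of_katoSporadic_of_posLevel` (p620968): the x8 leaf needs, of the W-81′ children {C1′ = K_spor,
  C2 = S4b, C4}, only C1′, the positive-level part of C2, and C4 — C2's `(T)`-clause at `r_an ≥ 2` (v8 S4b-T, «hard direction of signed
  3-adic BSD at `r_an ≥ 2`») is IDLE for the leaf, exactly as it is for route `SignedLowerHalves` (p621820).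

References: [Sprung2012] Thm. 7.14, Thm. 7.16 (p. 1504), Prop. 7.19 and Main Conj. 7.21 (p. 1505); [Kato2004Asterisque] Conj. 12.10 (p. 224);
[Miller2011LMS] §1 and Def. 1.1; [BurungaleKobayashiOta2023] App. A Cor. A.5; [Sprung2024] §5.2; [Vaserstein1972SL2] Theorem (p. 313); tree:
`PrintX8VSConjSpanGenAll` / `PrintX8VSGlue` / `PrintX8MainConjectureSplit` / `PrintX8MuGlue` / `PrintX8Assembly`, `…SurjBranch` (p534029),
`PrintX8SmallImageMuReading` (p539576), `…RankCut` (p620968).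
-/

set_option linter.dupNamespace false
set_option autoImplicit false

noncomputable section

open scoped Classical NumberField MatrixGroups ModularForm

open NumberField IsDedekindDomain CongruenceSubgroup WeierstrassCurve Field
  Literature.NumberTheory.EllipticCurves Literature.NumberTheory.EllipticCurves.ModularForms
  Literature.NumberTheory.EllipticCurves.ZpExtension Literature.NumberTheory.EllipticCurves.Sprung2017
  Literature.NumberTheory.EllipticCurves.Sprung2012 Literature.NumberTheory.EllipticCurves.Rank1Residual
  Literature.NumberTheory.EllipticCurves.IwasawaAlgebra Literature.NumberTheory.EllipticCurves.Kato2004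
  Summit.BirchSwinnertonDyer.BirchSwinnertonDyer.Theorems
  Summit.BirchSwinnertonDyer.BirchSwinnertonDyer.Theses
  Summit.BirchSwinnertonDyer.Rank1Residual.Supersingular

namespace Summit.BirchSwinnertonDyer.BirchSwinnertonDyer.Theorems.ChromaticCommonZeros

/-! ### §1 C1 `SharpFlatMainConjectureX8` from K1's predicate on the range `r_an ≤ 1` -/

/-- **C1 `PrintX8VS.SharpFlatMainConjectureX8` (Sprung's ♯/♭ main conjecture on every X8 pair of analytic rank `≤ 1`, both colours) from
«K1's predicate at the X8 pairs with `r_an ≤ 1`», the held Coleman–Kato/period input `InputSharpFlatMuTransfer` and the published bundle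
`PublishedInputsX8`.** THEOREM B (`PrintX8VSConjSpanGenAll.conjSpanGenAll_holds`) gives the `μ`-bound on the small-image pairs
(`PrintX8VSGlue.muBoundSmallImageX8_of_conjSpanGenAll`); then per pair: big image — `X8.sprungSharpFlatMainConjecture_of_lowerDivisibility_of_surj`
(Thm. 7.14/7.16 + period unit, conjuncts 4, 5, 7 of the bundle); small image — `PrintX8MuReading.X8.sprungSharpFlatMainConjecture_of_lowerDivisibility_of_muInvariant_le`.
Both consume K1's predicate at THAT pair only, where `r_an ≤ 1`. CONDITIONAL (displayed); closes nothing.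
[cite: Sprung2012, Thm. 7.14, Thm. 7.16 (p. 1504) and Main Conj. 7.21 (p. 1505)] [cite: Vaserstein1972SL2, Theorem (p. 313)] -/
theorem sharpFlatMainConjectureX8_of_lowerDivisibility_analyticRank_le_one
    (hK1le : ∀ (W : WeierstrassCurve ℚ) [W.IsElliptic] [W.IsGloballyMinimal] (p : ℕ) [Fact p.Prime],
      ClassX8 W p → W.analyticRank ≤ 1 → ∀ col : Chroma, SprungSharpFlatLowerDivisibility W p col)
    (hIn : PrintX8VS.InputSharpFlatMuTransfer) (hPub : PrintX8VS.PublishedInputsX8) :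
    PrintX8VS.SharpFlatMainConjectureX8 := by
  have hμ := PrintX8VSGlue.muBoundSmallImageX8_of_conjSpanGenAll PrintX8VSConjSpanGenAll.conjSpanGenAll_holds hIn
  obtain ⟨-, -, -, h714, h716, -, h3, -⟩ := hPub
  intro W _ _ p _ hX hr col
  by_cases hs : Surj W p
  · exact X8.sprungSharpFlatMainConjecture_of_lowerDivisibility_of_surj h714 h716 h3 W p hX hs col (hK1le W p hX hr col)
  · exact PrintX8MuReading.X8.sprungSharpFlatMainConjecture_of_lowerDivisibility_of_muInvariant_le h714 h716 h3 W p hX col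
      (hK1le W p hX hr col) (hμ W p hX hs hr col)

/-! ### §2 The x8 leaf from K1's predicate on the range `r_an ≤ 1` -/

/-- **The x8 leaf `WAllCornerX8` from «K1's predicate at the X8 pairs with `r_an ≤ 1`» and the held / published items of route `PrintX8VS`**
(`InputSharpFlatMuTransfer`, `PublishedInputsX8`, `RankEqAnalyticRankLeOne` = Gross–Zagier–Kolyvagin): §1, the two rank links
(`PrintX8VSGlue.glueRankOneLinkX8_holds`, `glueRankZeroLinkX8_holds`) and the assembly (`PrintX8VSGlue.assembly_holds`, a case split on the
analytic rank `≤ 1`). Compare `PrintX8VSConjSpanGenAll.wAllCornerX8_of_K1_of_heldInputs`, which takes K1 at every rank: the ranks `≥ 2` of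
item 19875 are idle for the leaf. CONDITIONAL (displayed); closes nothing. [cite: Miller2011LMS, §1 and Def. 1.1]
[cite: BurungaleKobayashiOta2023, App. A Cor. A.5] [cite: Sprung2024, §5.2, Lemma 5.9 and Thm. 5.3] -/
theorem wAllCornerX8_of_lowerDivisibility_analyticRank_le_one
    (hK1le : ∀ (W : WeierstrassCurve ℚ) [W.IsElliptic] [W.IsGloballyMinimal] (p : ℕ) [Fact p.Prime],
      ClassX8 W p → W.analyticRank ≤ 1 → ∀ col : Chroma, SprungSharpFlatLowerDivisibility W p col)
    (hIn : PrintX8VS.InputSharpFlatMuTransfer) (hPub : PrintX8VS.PublishedInputsX8)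
    (hGZK : PrintX8VS.RankEqAnalyticRankLeOne) : Summit.BirchSwinnertonDyer.WAllCornerX8 :=
  PrintX8VSGlue.assembly_holds (sharpFlatMainConjectureX8_of_lowerDivisibility_analyticRank_le_one hK1le hIn hPub)
    (PrintX8VSGlue.glueRankOneLinkX8_holds hPub hGZK) (PrintX8VSGlue.glueRankZeroLinkX8_holds hPub hGZK) hGZK

/-! ### §3 The x8 leaf from K_spor, the positive-level part of S4b, and the held inputs -/

section RankCut



-- The registered v7 stub K_spor VERBATIM (as in p614828) and the positive-level part of S4b VERBATIM (the hypothesis `hCyc` of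
-- the lead's split door p617801), as section hypotheses.
variable
  (hKsp :
    ∀ (W : WeierstrassCurve ℚ) [W.IsElliptic] [W.IsGloballyMinimal] (p : ℕ) [Fact p.Prime]
      [ContinuousSMul ℤ_[p] (W.tateModule p)] [Module.Free ℤ_[p] (W.tateModule p)]
      [Module.Finite ℤ_[p] (W.tateModule p)],
      ClassX8 W p → ∀ (κ : ZpExtension ℚ p) (γ : Field.absoluteGaloisGroup ℚ),
      κ.IsCyclotomic → κ.IsTopGenerator γ → IsCyclotomicVariable p γ →
    ∀ (v : HeightOneSpectrum (𝓞 ℚ)), (p : 𝓞 ℚ) ∈ v.asIdeal →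
    ∀ (g : Field.absoluteGaloisGroup (v.adicCompletion ℚ)),
      κ.IsTopGenerator (resGalOfEmb (closureEmb (K := ℚ) (v.adicCompletion ℚ)) g) →
    ∀ (cneg : localPoints W (v.adicCompletion ℚ)) (c : ℕ → localPoints W (v.adicCompletion ℚ)),
      IsHondaSystem κ (closureEmb (K := ℚ) (v.adicCompletion ℚ)) W (W.frobeniusTrace p) g cneg c →
    ∀ (N : ℕ) (_ : NeZero N) (f : CuspForm (Gamma0 N) 2) (ϖ : ℚ) (Lsharp Lflat : IwasawaAlgebra p),
      IsNewformOf W f → (ϖ : ℝ) * W.realPeriodRat = plusPeriod f →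
      IsSprungPair f p (W.frobeniusTrace p) Lsharp Lflat →
    ∀ (I : Kato2004.IwasawaH1Data W p κ γ)
      (Cs : SharpFlatColemanKatoData W p f ϖ κ γ (closureEmb (K := ℚ) (v.adicCompletion ℚ))
        (W.frobeniusTrace p) g c Chroma.sharp I)
      (Cf : SharpFlatColemanKatoData W p f ϖ κ γ (closureEmb (K := ℚ) (v.adicCompletion ℚ))
        (W.frobeniusTrace p) g c Chroma.flat I),
      Cs.Z = Cf.Z →
    ∀ (Y : W.FineSelmerDualData κ γ) (𝔭 : PrimeSpectrum (IwasawaAlgebra p)), 𝔭.asIdeal.height = 1 →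
      (p : IwasawaAlgebra p) ∉ 𝔭.asIdeal →
      (¬ ∃ n : ℕ, ((cyclotomicOmega p n).map (Int.castRingHom ℤ_[p]) : PowerSeries ℤ_[p]) ∈ 𝔭.asIdeal) →
      (∀ (col' : Chroma) (G' : IwasawaAlgebra p),
        iwasawaToPowerSeries p G' =
          PowerSeries.C (ϖ : ℚ_[p]) * iwasawaToPowerSeries p (chromaticL col' Lsharp Lflat) →
        G' ∈ 𝔭.asIdeal) →
      Module.lengthAt (IwasawaAlgebra p) (I.H ⧸ Cs.Z) 𝔭 ≤ Module.lengthAt (IwasawaAlgebra p) Y.X 𝔭)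
  (hCyc :
    ∀ (W : WeierstrassCurve ℚ) [W.IsElliptic] [W.IsGloballyMinimal] (p : ℕ) [Fact p.Prime]
      [ContinuousSMul ℤ_[p] (W.tateModule p)] [Module.Free ℤ_[p] (W.tateModule p)]
      [Module.Finite ℤ_[p] (W.tateModule p)],
      ClassX8 W p → ∀ (col : Chroma) (κ : ZpExtension ℚ p) (γ : Field.absoluteGaloisGroup ℚ),
      κ.IsCyclotomic → κ.IsTopGenerator γ → IsCyclotomicVariable p γ →
    ∀ (v : HeightOneSpectrum (𝓞 ℚ)), (p : 𝓞 ℚ) ∈ v.asIdeal →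
    ∀ (g : Field.absoluteGaloisGroup (v.adicCompletion ℚ)),
      κ.IsTopGenerator (resGalOfEmb (closureEmb (K := ℚ) (v.adicCompletion ℚ)) g) →
    ∀ (cneg : localPoints W (v.adicCompletion ℚ)) (c : ℕ → localPoints W (v.adicCompletion ℚ)),
      IsHondaSystem κ (closureEmb (K := ℚ) (v.adicCompletion ℚ)) W (W.frobeniusTrace p) g cneg c →
    ∀ (N : ℕ) (_ : NeZero N) (f : CuspForm (Gamma0 N) 2) (ϖ : ℚ) (Lsharp Lflat : IwasawaAlgebra p),
      IsNewformOf W f → (ϖ : ℝ) * W.realPeriodRat = plusPeriod f →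
      IsSprungPair f p (W.frobeniusTrace p) Lsharp Lflat → chromaticL col Lsharp Lflat ≠ 0 →
    ∀ (D : SharpFlatSelmerDualData W κ γ (closureEmb (K := ℚ) (v.adicCompletion ℚ))
        (W.frobeniusTrace p) g c col) [Module.Finite (IwasawaAlgebra p) D.X],
      Module.IsTorsion (IwasawaAlgebra p) D.X →
    ∀ (G : IwasawaAlgebra p),
      iwasawaToPowerSeries p G =
        PowerSeries.C (ϖ : ℚ_[p]) * iwasawaToPowerSeries p (chromaticL col Lsharp Lflat) →
    ∀ (I : Kato2004.IwasawaH1Data W p κ γ)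
      (Cs : SharpFlatColemanKatoData W p f ϖ κ γ (closureEmb (K := ℚ) (v.adicCompletion ℚ))
        (W.frobeniusTrace p) g c Chroma.sharp I)
      (Cf : SharpFlatColemanKatoData W p f ϖ κ γ (closureEmb (K := ℚ) (v.adicCompletion ℚ))
        (W.frobeniusTrace p) g c Chroma.flat I),
      Cs.Z = Cf.Z →
    ∀ 𝔭 : PrimeSpectrum (IwasawaAlgebra p), 𝔭.asIdeal.height = 1 →
      (PowerSeries.X : IwasawaAlgebra p) ∉ 𝔭.asIdeal →
      (∃ j : ℕ, 1 ≤ j ∧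
        ((((Polynomial.cyclotomic (p ^ j) ℤ).comp (Polynomial.X + 1)).map (Int.castRingHom ℤ_[p]) : Polynomial ℤ_[p]) :
          PowerSeries ℤ_[p]) ∈ 𝔭.asIdeal) →
      (∀ (col' : Chroma) (G' : IwasawaAlgebra p),
        iwasawaToPowerSeries p G' =
          PowerSeries.C (ϖ : ℚ_[p]) * iwasawaToPowerSeries p (chromaticL col' Lsharp Lflat) →
        G' ∈ 𝔭.asIdeal) →
      Module.lengthAt (IwasawaAlgebra p) (IwasawaAlgebra p ⧸ Ideal.span {G}) 𝔭 ≤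
        Module.lengthAt (IwasawaAlgebra p) D.X 𝔭)


include hKsp hCyc in
/-- **The x8 leaf `WAllCornerX8` from `hKsp ∧ hCyc ∧ C4 ∧ InputSharpFlatMuTransfer ∧ PublishedInputsX8 ∧ RankEqAnalyticRankLeOne`** — `hKsp` =
K_spor (= W-81′ child C1′ `KatoFineLowerBoundSporadicX8`) VERBATIM, `hCyc` = v8 S4b-cyc VERBATIM (the positive-level part of child C2
`ChromaticCyclotomicLowerRestX8`), C4 = `PrintX8VS.ChromaticHeldInputsX8` (the five held inputs of S5): §2 with the companion's class form
`lowerDivisibility_analyticRank_le_one_of_katoSporadic_of_posLevel` (p620968). So the leaf needs of C2 only its positive-level part — the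
`(T)`-clause at `r_an ≥ 2` (v8 stub S4b-T, the hard direction of the signed `3`-adic BSD rank inequality) is idle for route `PrintX8VS`, as
it is for route `SignedLowerHalves` (p621820). CONDITIONAL (displayed); closes nothing; calibration only (pen R-RANKCUT).
[cite: Kato2004Asterisque, Conj. 12.10 (p. 224)] [cite: Sprung2012, Main Conj. 7.21 (p. 1505)] [cite: Miller2011LMS, §1 and Def. 1.1] -/
theorem wAllCornerX8_of_katoSporadic_of_posLevel (hC4 : PrintX8VS.ChromaticHeldInputsX8)
    (hIn : PrintX8VS.InputSharpFlatMuTransfer) (hPub : PrintX8VS.PublishedInputsX8)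
    (hGZK : PrintX8VS.RankEqAnalyticRankLeOne) : Summit.BirchSwinnertonDyer.WAllCornerX8 := by
  obtain ⟨h714, h3, hJ, hGZK', hKob⟩ := hC4
  exact wAllCornerX8_of_lowerDivisibility_analyticRank_le_one
    (lowerDivisibility_analyticRank_le_one_of_katoSporadic_of_posLevel hKsp hCyc h714 h3 hJ hGZK' hKob) hIn hPub hGZK

end RankCut

end Summit.BirchSwinnertonDyer.BirchSwinnertonDyer.Theorems.ChromaticCommonZeros

end
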